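import Literature.AlgebraicGeometry.Frobenioids.Prop53Sub
import HarnessLib

/-!
# Frobenioids I, Prop. 5.3: `ι : C^istr → C^rlf` lies over `D` — the slot `IotaRlfOverBase` CLOSED

Mochizuki, *The geometry of Frobenioids I*, Kyushu J. Math. **62** (2008), Prop. 5.3 p. 103 ll. 20–33 (the natural
1-commutative diagram `C → C^istr → C^pf` / `C^un-tr → (C^un-tr)^pf → C^rlf`, "the remaining functors are the
functors that arise naturally from the construction", all over `D`) [cite: MochizukiFrdI2008, Prop. 5.3 p.103].

PROOF-ONLY closer of the named row `FrdI.Prop53Sub.IotaRlfOverBase F hΦ e` (P53/L05c' of `Prop53Sub.lean`, seat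
abc-iut-w5-d137): THE functor `C^un-tr-model → C^rlf` (`PreFrobenioid.untrToRlf`, seat abc-iut-L1-d2 — the
model-Frobenioid map along `(Φ, Φ^birat) → (Φ^rlf, ℝ · Φ^birat)`) preserves base objects and base maps ON THE NOSE
(`untrToRlf_comp_baseFunctor`), so `ι = toUntr ⋙ e ⋙ untrToRlf` lies over `D` as soon as `toUntr ⋙ e` does.
Seat abc-iut-L1-d2 (cell abc-iut).
-/

noncomputable section

namespace Literature.AlgebraicGeometry.Frobenioids

open CategoryTheory Opposite Literature.AnabelianGeometry.EtaleTheta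

universe w v v' u u'

namespace PreFrobenioid

variable {D : Type u} [Category.{v} D] {Φ : Dᵒᵖ ⥤ CommMonCat.{w}}
  {C : Type u'} [Category.{v'} C] (F : C ⥤ ElemFrobenioid Φ) (hΦ : IsPerfFactorialOn Φ)

/-- **`C^un-tr-model → C^rlf` lies over `D` on the nose**: `untrToRlf ⋙ Base = Base`.
[cite: MochizukiFrdI2008, Prop. 5.3 p.103] -/
theorem untrToRlf_comp_baseFunctor :
    untrToRlf F hΦ ⋙ ModelFrobenioid.baseFunctor _ _ _ = ModelFrobenioid.baseFunctor _ _ _ := rfl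

end PreFrobenioid

namespace FrdI.Prop53Sub

variable {D : Type u} [Category.{v} D] {Φ : Dᵒᵖ ⥤ CommMonCat.{w}}
  {C : Type u'} [Category.{v'} C] (F : C ⥤ ElemFrobenioid Φ)

/-- **Row P53/L05c' CLOSED: `ι : C^istr → C^rlf` lies over `D`** (granted the comparison equivalence
`e : C^un-tr ≌ untrModel F` does): `ι ⋙ Base = toUntr ⋙ e ⋙ (untrToRlf ⋙ Base) = toUntr ⋙ e ⋙ Base`.
[cite: MochizukiFrdI2008, Prop. 5.3 p.103] -/
theorem iotaRlfOverBase_holds (hΦ : PreFrobenioid.IsPerfFactorialOn Φ)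
    (e : (PreFrobenioidData.ofFunctor Φ F).Untr ≌ PreFrobenioid.untrModel F) : IotaRlfOverBase F hΦ e := by
  rintro ⟨h⟩
  exact ⟨h⟩

end FrdI.Prop53Sub

end Literature.AlgebraicGeometry.Frobenioids
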